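import Mathlib

/-!
# Cone lemmas for stub `stub_extendedGap` (`GapTwelveToBarlow`, line `Sketch`): the planar part

Crux `SquareWellLayerCake.GapTwelveToBarlow` (item stmt-AtomisticToContinuum-15807), stub
`stub_extendedGap` ("tolerant Lemma 2": four-deep inside an all-Good region no two sites are at
distance in `(1, 131/100)`).  The stub is reduced (files `…ExtendedGapCone`, `…ExtendedGapFaces`)
to the multi-shell core `LinkConesCover` through the FACE-CONE CERTIFICATE
`le_dist_of_cone_four_cycle` of `…ExtendedGapFaces`.  This file holds its two elementary inputs.

* `planar_four_cone_false`: four plane vectors `x → y → z → w → x` with consecutive inner products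
  `> 0` never have `0` in their conic hull (`αx + βy + γz + δw = 0`, `α, β, γ, δ ≥ 0` forces all
  weights to vanish).  Pairing the relation with each vector makes every weight positive and both
  diagonals obtuse; then the brackets `[x,y], [y,z], [z,w], [w,x]` have one strict sign and the
  sine addition formula `|y|²[x,z] = [x,y]⟪y,z⟫ + ⟪x,y⟫[y,z]` (and its twin through `w`) gives
  `[x,z]` and `[z,x]` the same strict sign.  Closed registered form: `stub_planarFourCone`.
* `side_inner_pos` / `cross_neg_false`: the scalar inequalities of the certificate.  Along the axis
  `e = (q − p)/t` write `σ_x = ⟪x − p, e⟫`, `P_x = x − p − σ_x e`; for a bonded side `(x, y)` of the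
  walk, `2⟪P_x, P_y⟫ = |px|² + |py|² − |xy|² − 2σ_xσ_y` and `2tσ_x = |px|² + t² − |qx|²`, and
  `⟪P_x, P_y⟫ > 0` as long as `t² < 4(55/57)² − 2` (`t < 1.3131`) unless `σ_x, σ_y < 0`, which the
  cone weights cannot afford (`cross_neg_false`, from `⟪a−p,c−p⟫ + ⟪b−p,d−p⟫ ≥ 2(55/57)² − 2`).

Pure real arithmetic (Mathlib only); no named fact is used.
-/

noncomputable section

namespace Summit.AtomisticToContinuum.Crystallization.Theorems.SquareWellLayerCakeGapTwelveToBarlow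

/-! ## Planar part: `0` is not in the conic hull of a positively-turning 4-cycle -/

/-- A plane vector with a positive inner product against something is nonzero. [folklore] -/
theorem normSq_pos_of_inner_pos {x₁ x₂ y₁ y₂ : ℝ} (h : 0 < x₁ * y₁ + x₂ * y₂) :
    0 < x₁ ^ 2 + x₂ ^ 2 := by
  by_contra! h0
  have h1 : x₁ ^ 2 = 0 := by nlinarith [sq_nonneg x₁, sq_nonneg x₂]
  have h2 : x₂ ^ 2 = 0 := by nlinarith [sq_nonneg x₁, sq_nonneg x₂]
  rw [pow_eq_zero_iff two_ne_zero] at h1 h2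
  rw [h1, h2] at h
  simp at h

/-- Non-negative weights against positive numbers summing to zero vanish. [folklore] -/
theorem weights_eq_zero {α β δ A B D : ℝ} (hα : 0 ≤ α) (hβ : 0 ≤ β) (hδ : 0 ≤ δ)
    (hA : 0 < A) (hB : 0 < B) (hD : 0 < D) (h : α * A + β * B + δ * D = 0) :
    α = 0 ∧ β = 0 ∧ δ = 0 := by
  have h1 := mul_nonneg hα hA.le
  have h2 := mul_nonneg hβ hB.le
  have h3 := mul_nonneg hδ hD.le
  refine ⟨le_antisymm ?_ hα, le_antisymm ?_ hβ, le_antisymm ?_ hδ⟩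
  · exact le_of_mul_le_mul_right (by linarith) hA
  · exact le_of_mul_le_mul_right (by linarith) hB
  · exact le_of_mul_le_mul_right (by linarith) hD

/-- **Four plane vectors `x → y → z → w → x` with consecutive inner products `> 0` do not have `0`
in their conic hull**: `αx + βy + γz + δw = 0` with `α, β, γ, δ ≥ 0` forces `α = β = γ = δ = 0`.
Pairing the relation with `x` (resp. `y, z, w`) shows `γ⟪x,z⟫ ≤ 0` with equality only if the other
three weights vanish, so all weights are positive and both diagonals are obtuse; then
`[x,y][y,z] = ⟪x,y⟫⟪y,z⟫ − |y|²⟪x,z⟫ > 0`, `[z,w][w,x] > 0`,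
`[x,y][x,w] = |x|²⟪y,w⟫ − ⟪x,y⟫⟪x,w⟫ < 0` fix all bracket signs, and
`|y|²[x,z] = [x,y]⟪y,z⟫ + ⟪x,y⟫[y,z]`, `|w|²[z,x] = [z,w]⟪w,x⟫ + ⟪z,w⟫[w,x]` have the same strict
sign although `[x,z] = −[z,x]`. [folklore] -/
theorem planar_four_cone_false (x₁ x₂ y₁ y₂ z₁ z₂ w₁ w₂ α β γ δ : ℝ)
    (hα : 0 ≤ α) (hβ : 0 ≤ β) (hγ : 0 ≤ γ) (hδ : 0 ≤ δ) (hpos : 0 < α + β + γ + δ)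
    (r₁ : α * x₁ + β * y₁ + γ * z₁ + δ * w₁ = 0) (r₂ : α * x₂ + β * y₂ + γ * z₂ + δ * w₂ = 0)
    (cxy : 0 < x₁ * y₁ + x₂ * y₂) (cyz : 0 < y₁ * z₁ + y₂ * z₂) (czw : 0 < z₁ * w₁ + z₂ * w₂)
    (cwx : 0 < w₁ * x₁ + w₂ * x₂) : False := by
  have nx := normSq_pos_of_inner_pos cxy
  have ny := normSq_pos_of_inner_pos cyz
  have nz := normSq_pos_of_inner_pos czw
  have nw := normSq_pos_of_inner_pos cwx
  -- the relation paired with each of the four vectors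
  have ex : α * (x₁ ^ 2 + x₂ ^ 2) + β * (x₁ * y₁ + x₂ * y₂) + γ * (x₁ * z₁ + x₂ * z₂) +
      δ * (w₁ * x₁ + w₂ * x₂) = 0 := by linear_combination x₁ * r₁ + x₂ * r₂
  have ey : α * (x₁ * y₁ + x₂ * y₂) + β * (y₁ ^ 2 + y₂ ^ 2) + γ * (y₁ * z₁ + y₂ * z₂) +
      δ * (y₁ * w₁ + y₂ * w₂) = 0 := by linear_combination y₁ * r₁ + y₂ * r₂
  have ez : α * (x₁ * z₁ + x₂ * z₂) + β * (y₁ * z₁ + y₂ * z₂) + γ * (z₁ ^ 2 + z₂ ^ 2) +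
      δ * (z₁ * w₁ + z₂ * w₂) = 0 := by linear_combination z₁ * r₁ + z₂ * r₂
  have ew : α * (w₁ * x₁ + w₂ * x₂) + β * (y₁ * w₁ + y₂ * w₂) + γ * (z₁ * w₁ + z₂ * w₂) +
      δ * (w₁ ^ 2 + w₂ ^ 2) = 0 := by linear_combination w₁ * r₁ + w₂ * r₂
  -- all four weights are positive
  have hγ' : 0 < γ := by
    by_contra h
    have h0 : γ = 0 := le_antisymm (not_lt.mp h) hγ
    obtain ⟨h1, h2, h3⟩ := weights_eq_zero hα hβ hδ nx cxy cwx (by rw [h0] at ex; linarith)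
    linarith
  have hα' : 0 < α := by
    by_contra h
    have h0 : α = 0 := le_antisymm (not_lt.mp h) hα
    obtain ⟨h1, h2, h3⟩ := weights_eq_zero hβ hγ hδ cyz nz czw (by rw [h0] at ez; linarith)
    linarith
  have hβ' : 0 < β := by
    by_contra h
    have h0 : β = 0 := le_antisymm (not_lt.mp h) hβ
    obtain ⟨h1, h2, h3⟩ := weights_eq_zero hα hγ hδ cwx czw nw (by rw [h0] at ew; linarith)
    linarith
  have hδ' : 0 < δ := by
    by_contra h
    have h0 : δ = 0 := le_antisymm (not_lt.mp h) hδ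
    obtain ⟨h1, h2, h3⟩ := weights_eq_zero hα hβ hγ cxy ny cyz (by rw [h0] at ey; linarith)
    linarith
  -- both diagonals are obtuse
  have dxz : x₁ * z₁ + x₂ * z₂ < 0 := by
    have h : γ * (x₁ * z₁ + x₂ * z₂) < 0 := by
      linarith [mul_pos hα' nx, mul_nonneg hβ cxy.le, mul_nonneg hδ cwx.le]
    exact neg_of_mul_neg_right h hγ'.le
  have dyw : y₁ * w₁ + y₂ * w₂ < 0 := by
    have h : δ * (y₁ * w₁ + y₂ * w₂) < 0 := by
      linarith [mul_pos hβ' ny, mul_nonneg hα cxy.le, mul_nonneg hγ cyz.le]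
    exact neg_of_mul_neg_right h hδ'.le
  -- bracket identities
  have I1 : (x₁ * y₂ - x₂ * y₁) * (y₁ * z₂ - y₂ * z₁) =
      (x₁ * y₁ + x₂ * y₂) * (y₁ * z₁ + y₂ * z₂) - (y₁ ^ 2 + y₂ ^ 2) * (x₁ * z₁ + x₂ * z₂) := by
    ring
  have I2 : (z₁ * w₂ - z₂ * w₁) * (w₁ * x₂ - w₂ * x₁) =
      (z₁ * w₁ + z₂ * w₂) * (w₁ * x₁ + w₂ * x₂) - (w₁ ^ 2 + w₂ ^ 2) * (x₁ * z₁ + x₂ * z₂) := by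
    ring
  have I3 : (x₁ * y₂ - x₂ * y₁) * (x₁ * w₂ - x₂ * w₁) =
      (x₁ ^ 2 + x₂ ^ 2) * (y₁ * w₁ + y₂ * w₂) - (x₁ * y₁ + x₂ * y₂) * (w₁ * x₁ + w₂ * x₂) := by
    ring
  have S1 : (y₁ ^ 2 + y₂ ^ 2) * (x₁ * z₂ - x₂ * z₁) =
      (x₁ * y₂ - x₂ * y₁) * (y₁ * z₁ + y₂ * z₂) + (x₁ * y₁ + x₂ * y₂) * (y₁ * z₂ - y₂ * z₁) := by
    ring
  have S2 : (w₁ ^ 2 + w₂ ^ 2) * (z₁ * x₂ - z₂ * x₁) =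
      (z₁ * w₂ - z₂ * w₁) * (w₁ * x₁ + w₂ * x₂) + (z₁ * w₁ + z₂ * w₂) * (w₁ * x₂ - w₂ * x₁) := by
    ring
  have B1 : 0 < (x₁ * y₂ - x₂ * y₁) * (y₁ * z₂ - y₂ * z₁) := by
    rw [I1]; linarith [mul_pos cxy cyz, mul_neg_of_pos_of_neg ny dxz]
  have B2 : 0 < (z₁ * w₂ - z₂ * w₁) * (w₁ * x₂ - w₂ * x₁) := by
    rw [I2]; linarith [mul_pos czw cwx, mul_neg_of_pos_of_neg nw dxz]
  have B3 : (x₁ * y₂ - x₂ * y₁) * (x₁ * w₂ - x₂ * w₁) < 0 := by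
    rw [I3]; linarith [mul_neg_of_pos_of_neg nx dyw, mul_pos cxy cwx]
  rcases pos_and_pos_or_neg_and_neg_of_mul_pos B1 with ⟨hxy, hyz⟩ | ⟨hxy, hyz⟩
  · have hxw : x₁ * w₂ - x₂ * w₁ < 0 := neg_of_mul_neg_right B3 hxy.le
    have hwx : 0 < w₁ * x₂ - w₂ * x₁ := by linarith
    have hzw : 0 < z₁ * w₂ - z₂ * w₁ := by
      rcases pos_and_pos_or_neg_and_neg_of_mul_pos B2 with ⟨h1, -⟩ | ⟨-, h2⟩
      · exact h1
      · linarith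
    have hxz : 0 < (y₁ ^ 2 + y₂ ^ 2) * (x₁ * z₂ - x₂ * z₁) := by
      rw [S1]; linarith [mul_pos hxy cyz, mul_pos cxy hyz]
    have hzx : 0 < (w₁ ^ 2 + w₂ ^ 2) * (z₁ * x₂ - z₂ * x₁) := by
      rw [S2]; linarith [mul_pos hzw cwx, mul_pos czw hwx]
    have h1 := (mul_pos_iff_of_pos_left ny).mp hxz
    have h2 := (mul_pos_iff_of_pos_left nw).mp hzx
    linarith
  · have hxw : 0 < x₁ * w₂ - x₂ * w₁ := by
      rcases mul_neg_iff.mp B3 with ⟨h1, -⟩ | ⟨-, h2⟩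
      · linarith
      · exact h2
    have hwx : w₁ * x₂ - w₂ * x₁ < 0 := by linarith
    have hzw : z₁ * w₂ - z₂ * w₁ < 0 := by
      rcases pos_and_pos_or_neg_and_neg_of_mul_pos B2 with ⟨-, h2⟩ | ⟨h1, -⟩
      · linarith
      · exact h1
    have hxz : (y₁ ^ 2 + y₂ ^ 2) * (x₁ * z₂ - x₂ * z₁) < 0 := by
      rw [S1]; linarith [mul_neg_of_neg_of_pos hxy cyz, mul_neg_of_pos_of_neg cxy hyz]
    have hzx : (w₁ ^ 2 + w₂ ^ 2) * (z₁ * x₂ - z₂ * x₁) < 0 := by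
      rw [S2]; linarith [mul_neg_of_neg_of_pos hzw cwx, mul_neg_of_pos_of_neg czw hwx]
    have h1 := neg_of_mul_neg_right hxz ny.le
    have h2 := neg_of_mul_neg_right hzx nw.le
    linarith

/-! ## Scalar inequalities -/

/-- The cone weights cannot make the axial coordinates of both ends of a side negative: from
`w₂·lo < w₁ X`, `w₁·lo < w₂ Y` (`w ≥ 0`, `lo > 0`) one gets `XY > lo²`, impossible when
`X + Y ≤ B` with `B² < 4 lo²`. [folklore] -/
theorem cross_neg_false {w₁ w₂ X Y lo B : ℝ} (hlo : 0 < lo) (hw₁ : 0 ≤ w₁) (hw₂ : 0 ≤ w₂)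
    (h1 : w₂ * lo < w₁ * X) (h2 : w₁ * lo < w₂ * Y) (hXY : X + Y ≤ B)
    (hB : B ^ 2 < 4 * lo ^ 2) : False := by
  have hw₁' : 0 < w₁ := by
    rcases hw₁.lt_or_eq with h | h
    · exact h
    · rw [← h, zero_mul] at h1; nlinarith [mul_nonneg hw₂ hlo.le]
  have hw₂' : 0 < w₂ := by
    rcases hw₂.lt_or_eq with h | h
    · exact h
    · rw [← h, zero_mul] at h2; nlinarith [mul_nonneg hw₁ hlo.le]
  have hX : 0 < X := by
    have : 0 < w₁ * X := lt_of_le_of_lt (mul_nonneg hw₂ hlo.le) h1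
    exact (mul_pos_iff_of_pos_left hw₁').mp this
  have hY : 0 < Y := by
    have : 0 < w₂ * Y := lt_of_le_of_lt (mul_nonneg hw₁ hlo.le) h2
    exact (mul_pos_iff_of_pos_left hw₂').mp this
  have h3 : (w₂ * lo) * (w₁ * lo) < (w₁ * X) * (w₂ * Y) :=
    mul_lt_mul'' h1 h2 (by positivity) (by positivity)
  have h4 : lo ^ 2 < X * Y := by
    have h5 : w₁ * w₂ * lo ^ 2 < w₁ * w₂ * (X * Y) := by nlinarith [h3]
    exact lt_of_mul_lt_mul_left h5 (by positivity)
  have hXY0 : 0 ≤ X + Y := by linarith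
  nlinarith [mul_nonneg (sub_nonneg.2 hXY) hXY0, mul_nonneg (sub_nonneg.2 hXY) (hXY0.trans hXY),
    sq_nonneg (X - Y)]

/-- **Side inequality.**  For a side `(x, y)` of the walk (`|px|², |py|² ∈ [(55/57)², 1]`,
`|xy|² ≤ 1`, `|qx|², |qy|² ≥ (55/57)²`, `2tσ = |p·|² + t² − |q·|²`, not both `σ < 0`; the bound
`|px|² ≤ 1` is not needed) the transversal
parts satisfy `⟪P_x, P_y⟫ > 0` while `1 < t < 131/100`: with `σ_x, σ_y ≥ 0`,
`4t²⟪P_x,P_y⟫ ≥ 2t²(A_x + A_y − 1) − (A_x + t² − s²)(A_y + t² − s²) ≥ t²(4s² − 2 − t²) > 0`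
(`s = 55/57`, monotone in `A_x, A_y`). [folklore] -/
theorem side_inner_pos {t Ax Ay Bx By D σx σy ip : ℝ} (ht1 : 1 < t) (ht2 : t < 131 / 100)
    (hAx1 : (55 / 57 : ℝ) ^ 2 ≤ Ax) (hAy1 : (55 / 57 : ℝ) ^ 2 ≤ Ay) (hAy2 : Ay ≤ 1)
    (hBx : (55 / 57 : ℝ) ^ 2 ≤ Bx) (hBy : (55 / 57 : ℝ) ^ 2 ≤ By) (hD : D ≤ 1)
    (h2x : 2 * t * σx = Ax + t ^ 2 - Bx) (h2y : 2 * t * σy = Ay + t ^ 2 - By)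
    (hnn : ¬ (σx < 0 ∧ σy < 0)) (hip : 2 * ip = Ax + Ay - D - 2 * (σx * σy)) : 0 < ip := by
  have ht0 : 0 < t := by linarith
  have htt : t ^ 2 < (131 / 100 : ℝ) ^ 2 := by nlinarith
  have htt1 : 1 < t ^ 2 := by nlinarith
  have key : 4 * t ^ 2 * ip = 2 * t ^ 2 * (Ax + Ay - D) - (2 * t * σx) * (2 * t * σy) := by
    have : 4 * t ^ 2 * ip = 2 * t ^ 2 * (2 * ip) := by ring
    rw [this, hip]; ring
  suffices h : 0 < 2 * t ^ 2 * (Ax + Ay - D) - (2 * t * σx) * (2 * t * σy) by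
    rw [← key] at h
    exact (mul_pos_iff_of_pos_left (by positivity)).mp h
  have hS : 0 < Ax + Ay - D := by norm_num at hAx1 hAy1; linarith
  have h2t : 0 < 2 * t ^ 2 * (Ax + Ay - D) := by positivity
  rcases le_or_gt 0 σx with hx | hx <;> rcases le_or_gt 0 σy with hy | hy
  · have hu : 2 * t * σx ≤ Ax + t ^ 2 - (55 / 57 : ℝ) ^ 2 := by linarith
    have hv : 2 * t * σy ≤ Ay + t ^ 2 - (55 / 57 : ℝ) ^ 2 := by linarith
    have hprod : (2 * t * σx) * (2 * t * σy) ≤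
        (Ax + t ^ 2 - (55 / 57 : ℝ) ^ 2) * (Ay + t ^ 2 - (55 / 57 : ℝ) ^ 2) :=
      mul_le_mul hu hv (by positivity) (by linarith)
    have e : 2 * t ^ 2 * (Ax + Ay - 1) -
        (Ax + t ^ 2 - (55 / 57 : ℝ) ^ 2) * (Ay + t ^ 2 - (55 / 57 : ℝ) ^ 2) =
        (Ax - (55 / 57 : ℝ) ^ 2) * (t ^ 2 - (Ay - (55 / 57 : ℝ) ^ 2)) +
          t ^ 2 * (Ay - (55 / 57 : ℝ) ^ 2) + t ^ 2 * (4 * (55 / 57 : ℝ) ^ 2 - 2 - t ^ 2) := by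
      ring
    have g1 : 0 ≤ (Ax - (55 / 57 : ℝ) ^ 2) * (t ^ 2 - (Ay - (55 / 57 : ℝ) ^ 2)) :=
      mul_nonneg (by linarith) (by linarith)
    have g2 : 0 ≤ t ^ 2 * (Ay - (55 / 57 : ℝ) ^ 2) := mul_nonneg (by positivity) (by linarith)
    have g3 : 0 < t ^ 2 * (4 * (55 / 57 : ℝ) ^ 2 - 2 - t ^ 2) :=
      mul_pos (by positivity) (by norm_num at htt ⊢; linarith)
    nlinarith [mul_nonneg (sq_nonneg t) (sub_nonneg.2 hD)]
  · have h : (2 * t * σx) * (2 * t * σy) ≤ 0 :=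
      mul_nonpos_of_nonneg_of_nonpos (by positivity) (by nlinarith)
    linarith
  · have h : (2 * t * σx) * (2 * t * σy) ≤ 0 :=
      mul_nonpos_of_nonpos_of_nonneg (by nlinarith) (by positivity)
    linarith
  · exact absurd ⟨hx, hy⟩ hnn

/-- Registered closed form of `planar_four_cone_false`: non-negative weights expressing `0` as a
combination of four plane vectors with consecutive inner products `> 0` all vanish. [folklore] -/
theorem stub_planarFourCone :
    ∀ x₁ x₂ y₁ y₂ z₁ z₂ w₁ w₂ α β γ δ : ℝ, 0 ≤ α → 0 ≤ β → 0 ≤ γ → 0 ≤ δ →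
      α * x₁ + β * y₁ + γ * z₁ + δ * w₁ = 0 → α * x₂ + β * y₂ + γ * z₂ + δ * w₂ = 0 →
      0 < x₁ * y₁ + x₂ * y₂ → 0 < y₁ * z₁ + y₂ * z₂ → 0 < z₁ * w₁ + z₂ * w₂ →
      0 < w₁ * x₁ + w₂ * x₂ → α + β + γ + δ = 0 := by
  intro x₁ x₂ y₁ y₂ z₁ z₂ w₁ w₂ α β γ δ hα hβ hγ hδ r₁ r₂ cxy cyz czw cwx
  by_contra h
  have hpos : 0 < α + β + γ + δ := lt_of_le_of_ne (by positivity) (Ne.symm h)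
  exact planar_four_cone_false x₁ x₂ y₁ y₂ z₁ z₂ w₁ w₂ α β γ δ hα hβ hγ hδ hpos r₁ r₂ cxy cyz
    czw cwx

end Summit.AtomisticToContinuum.Crystallization.Theorems.SquareWellLayerCakeGapTwelveToBarlow
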